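import Mathlib.Analysis.InnerProductSpace.PiL2
import Mathlib.MeasureTheory.Measure.Haar.InnerProductSpace
import Mathlib.MeasureTheory.Measure.Lebesgue.Basic
import Mathlib.MeasureTheory.Integral.Lebesgue.Add
import Literature.MathematicalPhysics.QuantumFieldTheory.Balaban1983to89.B4Eq19LatticeOperators
import HarnessLib

/-!
# LINE 25 «CompactnessTransfer» (crux `HistoryTailL` stmt-QuantumFields-19936 ∕ K2 crux `BlockLipschitzL` stmt-QuantumFields-23533), S2′ infrastructure (Γ1),
# FILE M2b: THE UNIFORM `L²`-TRANSLATION MODULUS OF THE ZERO-EXTENDED PIECEWISE-CONSTANT BLOW-DOWN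
# `∫⁻ ‖f(x − y) − f x‖ₑ² ≤ ofReal (144·(E∕R)·(t² + t) + 192·t)` for `|yᵢ| ≤ t ≤ 1`, UNIFORMLY in the mesh `R⁻¹`

Cell `ym3-torus` (YM ladder rung R3 = continuum SU(2) Yang–Mills on the three-torus — a RUNG, NOT the Clay problem: not d = 4, not infinite volume, not a mass gap);
width seat `ym3-torus-px3` gen 7, the Γ1 seat (road of record 11:24Z: (c3) of `blowDown_L2_compact` BY NAME through lit ✓`Literature.Analysis.FunctionSpaces.
exists_finset_eLpNorm_sub_lt_of_translate` — Kolmogorov–M. Riesz–Fréchet sufficiency — whose one non-trivial hypothesis is exactly this modulus; M1 (lattice paths) and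
M2a (two-grid cells) are its inputs, taken here AS DISPLAYED HYPOTHESES so that this file is Mathlib-only; the knit instantiates them by name).  THEOREMS ONLY
(def-free); `--supports` the K2 crux as a helper.  Nothing here proves Γ1, S2′, the organ, `BlockLipschitzL`, `HistoryTailL` or any summit statement.

THE ESTIMATE.  `f` = the blow-down `x ↦ v(⌊R x⌋)` of a lattice map `v : ℤ³ → F` with `‖v‖ ≤ 1` on the half-open cube `Q₀ = [−1,1)³`, extended by `0`; `R = N ≥ 1` an integer;
bond energy of `v` on the lattice cube `A = [−N, N−1]³` at most `E`; `|yᵢ| ≤ t ≤ 1`.  INTERIOR (`x, x − y ∈ Q₀`): the difference is `v(a) − v(a − w)` on the two-grid cell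
`T(a, w)` (`a = ⌊R x⌋`, shift `w ∈ Π{⌊R yᵢ⌋, ⌈R yᵢ⌉}`), so `∫ ≤ Σ_w vol(T(·, w))·Σ_{a ∈ A_w} ‖v a − v(a − w)‖² ≤ Σ_w (Π_i ℓᵢ(w))·3(Σ_j w_j²)·E` (M1), and `(Π ℓ)·w_j² ≤
R⁻²·(ℓ_j|w_j|)·|w_j| ≤ R⁻²·2t·(Rt + 1)` (M2a's slab bound) gives `≤ 144·(E∕R)·(t² + t)`; STRIP (exactly one of `x, x − y` in `Q₀`): the integrand is `≤ 1` on a union of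
three coordinate slabs of volume `≤ 64t` each.  Every integrand is a finite sum of indicators of boxes — `lintegral` currency, no integrability side conditions.
* §1 reals: `perShift_bound`, `sum_shifts_bound`.
* §2 the strip boxes: `measurableSet_stripBox`, ★ `volume_stripBox_le` (`≤ ofReal (64 t)`), `mem_stripBox_of_xor`.
* §3 ★★★ `lintegral_translate_sub_sq_le` — the modulus, with the M1∕M2a rows as hypotheses `hM1` (translation energy on the cube), `hvol` (two-grid cell volume),
  `hshift` (shift membership), `hT` (cell measurability).
[folklore] ([Adams1975] Thm 2.21 (the translation condition of the Kolmogorov–Riesz criterion); [AlicandroCicalese2008] §2; statements and proofs are this file's).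
-/

set_option autoImplicit false

noncomputable section

open scoped BigOperators ENNReal
open MeasureTheory Set Finset

namespace Summit.QuantumFields.YangMills.Theorems.PoincareLipschitzTranslationModulus

open Literature.MathematicalPhysics.QuantumFieldTheory.Balaban1983to89
open B4Eq19LatticeOperators (Zd unitVec)

/-! ## §1 Real bookkeeping -/

/-- **One shift**: with cell lengths `0 ≤ ℓᵢ ≤ R⁻¹`, shifts `0 ≤ mᵢ ≤ R t + 1` and the slab bound `ℓᵢ mᵢ ≤ 2t`,
`(Π_i ℓᵢ)·Σ_j m_j² ≤ 6 t (R t + 1) R⁻²`. [folklore] -/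
theorem perShift_bound {R t : ℝ} (hR : 0 < R) (ht : 0 ≤ t) (ℓ m : Fin 3 → ℝ) (hℓ0 : ∀ i, 0 ≤ ℓ i) (hℓ : ∀ i, ℓ i ≤ R⁻¹)
    (hm0 : ∀ i, 0 ≤ m i) (hm : ∀ i, m i ≤ R * t + 1) (hℓm : ∀ i, ℓ i * m i ≤ 2 * t) :
    (∏ i : Fin 3, ℓ i) * ∑ j : Fin 3, m j ^ 2 ≤ 6 * t * (R * t + 1) * R⁻¹ ^ 2 := by
  have hRi : 0 ≤ R⁻¹ := inv_nonneg.2 hR.le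
  rw [Fin.prod_univ_three, Fin.sum_univ_three]
  have key : ∀ (a b c ma : ℝ), 0 ≤ a → 0 ≤ b → b ≤ R⁻¹ → 0 ≤ c → c ≤ R⁻¹ → 0 ≤ ma → ma ≤ R * t + 1 → a * ma ≤ 2 * t →
      a * b * c * ma ^ 2 ≤ 2 * t * (R * t + 1) * R⁻¹ ^ 2 := by
    intro a b c ma ha hb hbR hc hcR hma hmaR ham
    have h1 : a * ma * ma ≤ 2 * t * (R * t + 1) := mul_le_mul ham hmaR hma (by positivity)
    have h2 : b * c ≤ R⁻¹ * R⁻¹ := mul_le_mul hbR hcR hc hRi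
    calc a * b * c * ma ^ 2 = (a * ma * ma) * (b * c) := by ring
      _ ≤ (2 * t * (R * t + 1)) * (R⁻¹ * R⁻¹) := mul_le_mul h1 h2 (mul_nonneg hb hc) (by positivity)
      _ = 2 * t * (R * t + 1) * R⁻¹ ^ 2 := by ring
  have k0 := key (ℓ 0) (ℓ 1) (ℓ 2) (m 0) (hℓ0 0) (hℓ0 1) (hℓ 1) (hℓ0 2) (hℓ 2) (hm0 0) (hm 0) (hℓm 0)
  have k1 := key (ℓ 1) (ℓ 0) (ℓ 2) (m 1) (hℓ0 1) (hℓ0 0) (hℓ 0) (hℓ0 2) (hℓ 2) (hm0 1) (hm 1) (hℓm 1)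
  have k2 := key (ℓ 2) (ℓ 0) (ℓ 1) (m 2) (hℓ0 2) (hℓ0 0) (hℓ 0) (hℓ0 1) (hℓ 1) (hm0 2) (hm 2) (hℓm 2)
  nlinarith [k0, k1, k2]

/-- **All shifts**: over at most `8` shifts, `3E·Σ_w (Πℓ)(Σ_j w_j²) ≤ 144·(E∕R)·(t² + t)` (`R ≥ 1`, `E ≥ 0`). [folklore] -/
theorem sum_shifts_bound {ι : Type*} (W : Finset ι) (hW : W.card ≤ 8) {R t E : ℝ} (hR : 1 ≤ R) (ht : 0 ≤ t) (hE : 0 ≤ E)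
    (Φ : ι → ℝ) (hΦ : ∀ w ∈ W, Φ w ≤ 6 * t * (R * t + 1) * R⁻¹ ^ 2) :
    3 * E * ∑ w ∈ W, Φ w ≤ 144 * (E / R) * (t ^ 2 + t) := by
  have hR0 : 0 < R := by linarith
  have h1 : ∑ w ∈ W, Φ w ≤ W.card • (6 * t * (R * t + 1) * R⁻¹ ^ 2) := Finset.sum_le_card_nsmul _ _ _ hΦ
  rw [nsmul_eq_mul] at h1
  have h2 : (W.card : ℝ) * (6 * t * (R * t + 1) * R⁻¹ ^ 2) ≤ 8 * (6 * t * (R * t + 1) * R⁻¹ ^ 2) :=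
    mul_le_mul_of_nonneg_right (by exact_mod_cast hW) (by positivity)
  have h3 : 8 * (6 * t * (R * t + 1) * R⁻¹ ^ 2) ≤ 48 * R⁻¹ * (t ^ 2 + t) := by
    -- `t (Rt + 1) R⁻² = R⁻¹ t² + R⁻² t ≤ R⁻¹ (t² + t)` since `R⁻¹ ≤ 1`
    have hRi : R⁻¹ ≤ 1 := inv_le_one_of_one_le₀ hR
    have hRi0 : 0 ≤ R⁻¹ := inv_nonneg.2 hR0.le
    have e : 6 * t * (R * t + 1) * R⁻¹ ^ 2 = 6 * (R⁻¹ * t ^ 2 * (R * R⁻¹) + R⁻¹ * (R⁻¹ * t)) := by ring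
    rw [e, mul_inv_cancel₀ hR0.ne']
    nlinarith [mul_le_of_le_one_left ht hRi]
  calc 3 * E * ∑ w ∈ W, Φ w ≤ 3 * E * (48 * R⁻¹ * (t ^ 2 + t)) := by
        exact mul_le_mul_of_nonneg_left (h1.trans (h2.trans h3)) (by positivity)
    _ = 144 * (E / R) * (t ^ 2 + t) := by rw [div_eq_mul_inv]; ring

/-! ## §2 The strip boxes -/

/-- The `i`-th strip box `{|x_j| ≤ 2 ∀ j, xᵢ ∈ [−1−t, −1+t] ∪ [1−t, 1+t]}` is measurable. [folklore] -/
theorem measurableSet_stripBox (t : ℝ) (i : Fin 3) :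
    MeasurableSet ((WithLp.ofLp : EuclideanSpace ℝ (Fin 3) → (Fin 3 → ℝ)) ⁻¹'
      (Set.pi Set.univ fun j => if j = i then Set.Icc (-1 - t) (-1 + t) ∪ Set.Icc (1 - t) (1 + t) else Set.Icc (-2 : ℝ) 2)) := by
  refine (MeasurableSet.univ_pi fun j => ?_).preimage (PiLp.volume_preserving_ofLp (Fin 3)).measurable
  by_cases h : j = i
  · simp only [h, if_true]; exact measurableSet_Icc.union measurableSet_Icc
  · simp only [h, if_false]; exact measurableSet_Icc

/-- ★ **The strip box has volume `≤ 64 t`** (`0 ≤ t`). [folklore] -/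
theorem volume_stripBox_le {t : ℝ} (ht : 0 ≤ t) (i : Fin 3) :
    volume ((WithLp.ofLp : EuclideanSpace ℝ (Fin 3) → (Fin 3 → ℝ)) ⁻¹'
      (Set.pi Set.univ fun j => if j = i then Set.Icc (-1 - t) (-1 + t) ∪ Set.Icc (1 - t) (1 + t) else Set.Icc (-2 : ℝ) 2))
      ≤ ENNReal.ofReal (64 * t) := by
  have hmeas : ∀ j : Fin 3, MeasurableSet (if j = i then Set.Icc (-1 - t) (-1 + t) ∪ Set.Icc (1 - t) (1 + t) else Set.Icc (-2 : ℝ) 2) := by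
    intro j
    by_cases h : j = i
    · simp only [h, if_true]; exact measurableSet_Icc.union measurableSet_Icc
    · simp only [h, if_false]; exact measurableSet_Icc
  rw [(PiLp.volume_preserving_ofLp (Fin 3)).measure_preimage (MeasurableSet.univ_pi hmeas).nullMeasurableSet, volume_pi_pi]
  -- factor bounds
  have hfac : ∀ j : Fin 3, volume (if j = i then Set.Icc (-1 - t) (-1 + t) ∪ Set.Icc (1 - t) (1 + t) else Set.Icc (-2 : ℝ) 2)
      ≤ ENNReal.ofReal (if j = i then 4 * t else 4) := by
    intro j
    by_cases h : j = i
    · simp only [h, if_true]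
      calc volume (Set.Icc (-1 - t) (-1 + t) ∪ Set.Icc (1 - t) (1 + t))
          ≤ volume (Set.Icc (-1 - t) (-1 + t)) + volume (Set.Icc (1 - t) (1 + t)) := measure_union_le _ _
        _ = ENNReal.ofReal (4 * t) := by
            rw [Real.volume_Icc, Real.volume_Icc, ← ENNReal.ofReal_add (by linarith) (by linarith)]
            congr 1; ring
    · simp only [h, if_false, Real.volume_Icc]
      exact le_of_eq (by norm_num)
  calc ∏ j : Fin 3, volume (if j = i then Set.Icc (-1 - t) (-1 + t) ∪ Set.Icc (1 - t) (1 + t) else Set.Icc (-2 : ℝ) 2)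
      ≤ ∏ j : Fin 3, ENNReal.ofReal (if j = i then 4 * t else 4) := Finset.prod_le_prod' fun j _ => hfac j
    _ = ENNReal.ofReal (∏ j : Fin 3, (if j = i then 4 * t else 4)) :=
        (ENNReal.ofReal_prod_of_nonneg fun j _ => by split_ifs <;> positivity).symm
    _ = ENNReal.ofReal (64 * t) := by
        congr 1
        fin_cases i <;> simp [Fin.prod_univ_three] <;> ring

/-- If exactly one of `x`, `x − y` lies in `Q₀ = [−1,1)³` and `|y_j| ≤ t ≤ 1`, then `x` lies in one of the three strip boxes. [folklore] -/
theorem mem_stripBox_of_xor {t : ℝ} (ht1 : t ≤ 1) (x y : EuclideanSpace ℝ (Fin 3)) (hy : ∀ j, |y j| ≤ t)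
    (h : (∀ j, -1 ≤ x j ∧ x j < 1) ↔ ¬ (∀ j, -1 ≤ x j - y j ∧ x j - y j < 1)) :
    ∃ i : Fin 3, x ∈ (WithLp.ofLp : EuclideanSpace ℝ (Fin 3) → (Fin 3 → ℝ)) ⁻¹'
      (Set.pi Set.univ fun j => if j = i then Set.Icc (-1 - t) (-1 + t) ∪ Set.Icc (1 - t) (1 + t) else Set.Icc (-2 : ℝ) 2) := by
  have hyb : ∀ j, -t ≤ y j ∧ y j ≤ t := fun j => abs_le.1 (hy j)
  -- all coordinates of `x` are in `[−2, 2]`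
  have hx2 : ∀ j, -2 ≤ x j ∧ x j ≤ 2 := by
    intro j
    by_cases hx : ∀ j, -1 ≤ x j ∧ x j < 1
    · have := hx j; constructor <;> linarith
    · have hxy : ∀ j, -1 ≤ x j - y j ∧ x j - y j < 1 := by
        by_contra hc; exact hx (h.2 hc)
      have := hxy j
      constructor <;> linarith [(hyb j).1, (hyb j).2, this.1, this.2]
  -- the special coordinate
  have main : ∃ i : Fin 3, x i ∈ Set.Icc (-1 - t) (-1 + t) ∪ Set.Icc (1 - t) (1 + t) := by
    by_cases hx : ∀ j, -1 ≤ x j ∧ x j < 1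
    · have hxy : ¬ (∀ j, -1 ≤ x j - y j ∧ x j - y j < 1) := h.1 hx
      push Not at hxy
      obtain ⟨i, hi⟩ := hxy
      refine ⟨i, ?_⟩
      have hxi := hx i
      by_cases hlo : -1 ≤ x i - y i
      · have hhi := hi hlo
        right; rw [Set.mem_Icc]; constructor <;> linarith [(hyb i).1, (hyb i).2]
      · push Not at hlo
        left; rw [Set.mem_Icc]; constructor <;> linarith [(hyb i).1, (hyb i).2]
    · have hxy : ∀ j, -1 ≤ x j - y j ∧ x j - y j < 1 := by
        by_contra hc; exact hx (h.2 hc)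
      push Not at hx
      obtain ⟨i, hi⟩ := hx
      refine ⟨i, ?_⟩
      have hxyi := hxy i
      by_cases hlo : -1 ≤ x i
      · have hhi := hi hlo
        right; rw [Set.mem_Icc]; constructor <;> linarith [(hyb i).1, (hyb i).2]
      · push Not at hlo
        left; rw [Set.mem_Icc]; constructor <;> linarith [(hyb i).1, (hyb i).2]
  obtain ⟨i, hi⟩ := main
  refine ⟨i, ?_⟩
  simp only [Set.mem_preimage, Set.mem_pi, Set.mem_univ, true_implies]
  intro j
  by_cases hj : j = i
  · subst hj; simp only [if_true]; exact hi
  · simp only [hj, if_false, Set.mem_Icc]; exact hx2 j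


/-! ## §3 ★★★ The modulus -/

/-- ★★★ **THE UNIFORM `L²`-TRANSLATION MODULUS OF THE ZERO-EXTENDED PIECEWISE-CONSTANT BLOW-DOWN.**  Data: a lattice map `v : ℤ³ → F` with `‖v‖ ≤ 1`, an integer
mesh `R = N ≥ 1`, the blow-down `f` (`= v(⌊R x⌋)` on `Q₀ = [−1,1)³`, `= 0` off it), a translation `y` with `|yᵢ| ≤ t ≤ 1`.  Displayed rows (discharged by name in the knit):
`hshift`∕`hwabs` (the two grids differ by a shift `w ∈ W`, `#W ≤ 8`, `|wᵢ| ≤ R|yᵢ| + 1` — FILE M2a), `hT`∕`hvol`∕`hℓ*` (the two-grid cells are measurable with volume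
`≤ Π ℓᵢ(w)`, `0 ≤ ℓᵢ ≤ R⁻¹`, slab bound `ℓᵢ|wᵢ| ≤ 2|yᵢ|` — M2a), `hM1` (translation energy on the cube `≤ 3(Σ_j w_j²)·E` — FILE M1 with the bond energy `≤ E`).
CONCLUSION: `∫⁻ ‖f(x − y) − f x‖ₑ² dx ≤ ofReal (144·(E∕R)·(t² + t) + 192·t)` — uniform in `R`, `→ 0` as `t → 0`: the translation condition of the Kolmogorov–Riesz
criterion. [folklore] [cite: Adams1975, Thm 2.21; AlicandroCicalese2008, §2] -/
theorem lintegral_translate_sub_sq_le {F : Type*} [NormedAddCommGroup F]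
    (v : Zd 3 → F) (hv : ∀ p, ‖v p‖ ≤ 1) (N : ℕ) (hN : 1 ≤ N)
    (f : EuclideanSpace ℝ (Fin 3) → F)
    (hf_in : ∀ x : EuclideanSpace ℝ (Fin 3), (∀ i, -1 ≤ x i ∧ x i < 1) → f x = v (fun i => ⌊(N : ℝ) * x i⌋))
    (hf_out : ∀ x : EuclideanSpace ℝ (Fin 3), ¬ (∀ i, -1 ≤ x i ∧ x i < 1) → f x = 0)
    {E : ℝ} (hE : 0 ≤ E) (y : EuclideanSpace ℝ (Fin 3)) {t : ℝ} (ht : ∀ i, |y i| ≤ t) (ht1 : t ≤ 1)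
    (W : Finset (Zd 3)) (hW : W.card ≤ 8)
    (hshift : ∀ x : EuclideanSpace ℝ (Fin 3), ((fun i => ⌊(N : ℝ) * x i⌋) - fun i => ⌊(N : ℝ) * (x i - y i)⌋ : Zd 3) ∈ W)
    (hwabs : ∀ w ∈ W, ∀ i, |(w i : ℝ)| ≤ (N : ℝ) * |y i| + 1)
    (ℓ : Zd 3 → Fin 3 → ℝ) (hℓ0 : ∀ w i, 0 ≤ ℓ w i) (hℓ1 : ∀ w i, ℓ w i ≤ ((N : ℝ))⁻¹) (hℓm : ∀ w i, ℓ w i * |(w i : ℝ)| ≤ 2 * |y i|)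
    (hT : ∀ a w : Zd 3, MeasurableSet {x : EuclideanSpace ℝ (Fin 3) | (∀ i, ⌊(N : ℝ) * x i⌋ = a i) ∧ (∀ i, ⌊(N : ℝ) * (x i - y i)⌋ = a i - w i)})
    (hvol : ∀ a w : Zd 3, volume {x : EuclideanSpace ℝ (Fin 3) | (∀ i, ⌊(N : ℝ) * x i⌋ = a i) ∧ (∀ i, ⌊(N : ℝ) * (x i - y i)⌋ = a i - w i)}
      ≤ ENNReal.ofReal (∏ i : Fin 3, ℓ w i))
    (hM1 : ∀ w ∈ W, ∑ a ∈ Fintype.piFinset (fun i : Fin 3 => Finset.Icc (max (-(N : ℤ)) (-(N : ℤ) + w i)) (min ((N : ℤ) - 1) ((N : ℤ) - 1 + w i))),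
      ‖v a - v (a - w)‖ ^ 2 ≤ 3 * (∑ j : Fin 3, ((w j : ℤ) : ℝ) ^ 2) * E) :
    ∫⁻ x, ‖f (x - y) - f x‖ₑ ^ 2 ≤ ENNReal.ofReal (144 * (E / N) * (t ^ 2 + t) + 192 * t) := by
  classical
  have hR1 : (1 : ℝ) ≤ (N : ℝ) := by exact_mod_cast hN
  have hR : (0 : ℝ) < N := by linarith
  have ht0 : 0 ≤ t := (abs_nonneg _).trans (ht 0)
  -- abbreviations
  set T : Zd 3 → Zd 3 → Set (EuclideanSpace ℝ (Fin 3)) :=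
    fun a w => {x | (∀ i, ⌊(N : ℝ) * x i⌋ = a i) ∧ (∀ i, ⌊(N : ℝ) * (x i - y i)⌋ = a i - w i)} with hTdef
  set A : Zd 3 → Finset (Zd 3) :=
    fun w => Fintype.piFinset (fun i : Fin 3 => Finset.Icc (max (-(N : ℤ)) (-(N : ℤ) + w i)) (min ((N : ℤ) - 1) ((N : ℤ) - 1 + w i))) with hAdef
  set B : Fin 3 → Set (EuclideanSpace ℝ (Fin 3)) := fun i => (WithLp.ofLp : EuclideanSpace ℝ (Fin 3) → (Fin 3 → ℝ)) ⁻¹'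
      (Set.pi Set.univ fun j => if j = i then Set.Icc (-1 - t) (-1 + t) ∪ Set.Icc (1 - t) (1 + t) else Set.Icc (-2 : ℝ) 2) with hBdef
  set G : EuclideanSpace ℝ (Fin 3) → ℝ≥0∞ := fun x =>
    (∑ w ∈ W, ∑ a ∈ A w, (T a w).indicator (fun _ => ENNReal.ofReal (‖v a - v (a - w)‖ ^ 2)) x)
      + ∑ i : Fin 3, (B i).indicator (fun _ => (1 : ℝ≥0∞)) x with hGdef
  ---- the pointwise domination
  have hpt : ∀ x, ‖f (x - y) - f x‖ₑ ^ 2 ≤ G x := by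
    intro x
    by_cases hx : ∀ i, -1 ≤ x i ∧ x i < 1
    · by_cases hxy : ∀ i, -1 ≤ x i - y i ∧ x i - y i < 1
      · -- interior: both in `Q₀`
        set a₀ : Zd 3 := fun i => ⌊(N : ℝ) * x i⌋ with ha₀
        set b₀ : Zd 3 := fun i => ⌊(N : ℝ) * (x i - y i)⌋ with hb₀
        set w₀ : Zd 3 := a₀ - b₀ with hw₀
        have hfx : f x = v a₀ := hf_in x hx
        have hfxy : f (x - y) = v b₀ := hf_in (x - y) hxy
        have hwW : w₀ ∈ W := hshift x
        have hab : b₀ = a₀ - w₀ := by rw [hw₀]; abel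
        have ha_bd : ∀ i, -(N : ℤ) ≤ a₀ i ∧ a₀ i ≤ (N : ℤ) - 1 := by
          intro i
          have h1 := (hx i).1
          have h2 := (hx i).2
          constructor
          · rw [ha₀]; apply Int.le_floor.2; push_cast; nlinarith
          · have : a₀ i < (N : ℤ) := by rw [ha₀]; apply Int.floor_lt.2; push_cast; nlinarith
            omega
        have hb_bd : ∀ i, -(N : ℤ) ≤ b₀ i ∧ b₀ i ≤ (N : ℤ) - 1 := by
          intro i
          have h1 := (hxy i).1
          have h2 := (hxy i).2
          constructor
          · rw [hb₀]; apply Int.le_floor.2; push_cast; nlinarith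
          · have : b₀ i < (N : ℤ) := by rw [hb₀]; apply Int.floor_lt.2; push_cast; nlinarith
            omega
        have haA : a₀ ∈ A w₀ := by
          rw [hAdef, Fintype.mem_piFinset]
          intro i
          rw [Finset.mem_Icc, max_le_iff, le_min_iff]
          have h1 := ha_bd i
          have h2 := hb_bd i
          have e : b₀ i = a₀ i - w₀ i := by rw [hab]; rfl
          rw [e] at h2
          omega
        have hxT : x ∈ T a₀ w₀ := by
          refine ⟨fun i => rfl, fun i => ?_⟩
          have e : b₀ i = a₀ i - w₀ i := by rw [hab]; rfl
          rw [← e]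
        have hval : ‖f (x - y) - f x‖ₑ ^ 2 = ENNReal.ofReal (‖v a₀ - v (a₀ - w₀)‖ ^ 2) := by
          rw [hfx, hfxy, hab, norm_sub_rev, ← ofReal_norm, ENNReal.ofReal_pow (norm_nonneg _), norm_sub_rev]
        rw [hval]
        calc ENNReal.ofReal (‖v a₀ - v (a₀ - w₀)‖ ^ 2)
            = (T a₀ w₀).indicator (fun _ => ENNReal.ofReal (‖v a₀ - v (a₀ - w₀)‖ ^ 2)) x :=
              (Set.indicator_of_mem hxT (fun _ => ENNReal.ofReal (‖v a₀ - v (a₀ - w₀)‖ ^ 2))).symm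
          _ ≤ ∑ a ∈ A w₀, (T a w₀).indicator (fun _ => ENNReal.ofReal (‖v a - v (a - w₀)‖ ^ 2)) x :=
              Finset.single_le_sum (f := fun a => (T a w₀).indicator (fun _ => ENNReal.ofReal (‖v a - v (a - w₀)‖ ^ 2)) x)
                (fun _ _ => zero_le) haA
          _ ≤ ∑ w ∈ W, ∑ a ∈ A w, (T a w).indicator (fun _ => ENNReal.ofReal (‖v a - v (a - w)‖ ^ 2)) x :=
              Finset.single_le_sum (f := fun w => ∑ a ∈ A w, (T a w).indicator (fun _ => ENNReal.ofReal (‖v a - v (a - w)‖ ^ 2)) x)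
                (fun _ _ => zero_le) hwW
          _ ≤ G x := le_self_add
      · -- strip: `x ∈ Q₀`, `x − y ∉ Q₀`
        have hfxy : f (x - y) = 0 := hf_out (x - y) hxy
        have hle : ‖f (x - y) - f x‖ₑ ^ 2 ≤ 1 := by
          rw [hfxy, zero_sub, enorm_neg, hf_in x hx, ← ofReal_norm, ← ENNReal.ofReal_one]
          rw [← ENNReal.ofReal_pow (norm_nonneg _)]
          exact ENNReal.ofReal_le_ofReal (by nlinarith [hv (fun i => ⌊(N : ℝ) * x i⌋), norm_nonneg (v (fun i => ⌊(N : ℝ) * x i⌋))])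
        obtain ⟨i, hi⟩ := mem_stripBox_of_xor ht1 x y ht ⟨fun _ => hxy, fun _ => hx⟩
        calc ‖f (x - y) - f x‖ₑ ^ 2 ≤ 1 := hle
          _ = (B i).indicator (fun _ => (1 : ℝ≥0∞)) x := (Set.indicator_of_mem hi (fun _ => (1 : ℝ≥0∞))).symm
          _ ≤ ∑ i : Fin 3, (B i).indicator (fun _ => (1 : ℝ≥0∞)) x :=
              Finset.single_le_sum (f := fun i => (B i).indicator (fun _ => (1 : ℝ≥0∞)) x) (fun _ _ => zero_le) (Finset.mem_univ i)
          _ ≤ G x := le_add_self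
    · by_cases hxy : ∀ i, -1 ≤ x i - y i ∧ x i - y i < 1
      · -- strip: `x ∉ Q₀`, `x − y ∈ Q₀`
        have hfx : f x = 0 := hf_out x hx
        have hfxy : f (x - y) = v (fun i => ⌊(N : ℝ) * (x i - y i)⌋) := hf_in (x - y) hxy
        have hle : ‖f (x - y) - f x‖ₑ ^ 2 ≤ 1 := by
          rw [hfx, sub_zero, hfxy, ← ofReal_norm, ← ENNReal.ofReal_one, ← ENNReal.ofReal_pow (norm_nonneg _)]
          exact ENNReal.ofReal_le_ofReal (by
            nlinarith [hv (fun i => ⌊(N : ℝ) * (x i - y i)⌋), norm_nonneg (v (fun i => ⌊(N : ℝ) * (x i - y i)⌋))])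
        obtain ⟨i, hi⟩ := mem_stripBox_of_xor ht1 x y ht ⟨fun h => (hx h).elim, fun h => (h hxy).elim⟩
        calc ‖f (x - y) - f x‖ₑ ^ 2 ≤ 1 := hle
          _ = (B i).indicator (fun _ => (1 : ℝ≥0∞)) x := (Set.indicator_of_mem hi (fun _ => (1 : ℝ≥0∞))).symm
          _ ≤ ∑ i : Fin 3, (B i).indicator (fun _ => (1 : ℝ≥0∞)) x :=
              Finset.single_le_sum (f := fun i => (B i).indicator (fun _ => (1 : ℝ≥0∞)) x) (fun _ _ => zero_le) (Finset.mem_univ i)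
          _ ≤ G x := le_add_self
      · -- both outside
        rw [hf_out x hx, hf_out (x - y) hxy, sub_zero, enorm_zero, zero_pow two_ne_zero]
        exact zero_le
  ---- integrate the dominating function
  have hmeasT : ∀ w a, Measurable ((T a w).indicator (fun _ : EuclideanSpace ℝ (Fin 3) => ENNReal.ofReal (‖v a - v (a - w)‖ ^ 2))) :=
    fun w a => measurable_const.indicator (hT a w)
  have hmeasB : ∀ i, Measurable ((B i).indicator (fun _ : EuclideanSpace ℝ (Fin 3) => (1 : ℝ≥0∞))) :=
    fun i => measurable_const.indicator (measurableSet_stripBox t i)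
  have hmeas1 : Measurable (fun x => ∑ w ∈ W, ∑ a ∈ A w, (T a w).indicator (fun _ => ENNReal.ofReal (‖v a - v (a - w)‖ ^ 2)) x) :=
    Finset.measurable_sum _ fun w _ => Finset.measurable_sum _ fun a _ => hmeasT w a
  have hint : ∫⁻ x, G x = (∑ w ∈ W, ∑ a ∈ A w, ENNReal.ofReal (‖v a - v (a - w)‖ ^ 2) * volume (T a w)) + ∑ i : Fin 3, volume (B i) := by
    rw [hGdef, lintegral_add_left hmeas1]
    congr 1
    · rw [lintegral_finsetSum _ (fun w _ => Finset.measurable_sum _ fun a _ => hmeasT w a)]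
      refine Finset.sum_congr rfl fun w _ => ?_
      rw [lintegral_finsetSum _ (fun a _ => hmeasT w a)]
      refine Finset.sum_congr rfl fun a _ => ?_
      exact lintegral_indicator_const (hT a w) _
    · rw [lintegral_finsetSum _ (fun i _ => hmeasB i)]
      refine Finset.sum_congr rfl fun i _ => ?_
      rw [lintegral_indicator_const (measurableSet_stripBox t i), one_mul]
  ---- the interior sum, in reals
  have hinner : ∀ w ∈ W, ∑ a ∈ A w, ENNReal.ofReal (‖v a - v (a - w)‖ ^ 2) * volume (T a w)
      ≤ ENNReal.ofReal ((∏ i : Fin 3, ℓ w i) * (3 * (∑ j : Fin 3, ((w j : ℤ) : ℝ) ^ 2) * E)) := by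
    intro w hw
    have hprod : 0 ≤ ∏ i : Fin 3, ℓ w i := Finset.prod_nonneg fun i _ => hℓ0 w i
    calc ∑ a ∈ A w, ENNReal.ofReal (‖v a - v (a - w)‖ ^ 2) * volume (T a w)
        ≤ ∑ a ∈ A w, ENNReal.ofReal (‖v a - v (a - w)‖ ^ 2) * ENNReal.ofReal (∏ i : Fin 3, ℓ w i) :=
          Finset.sum_le_sum fun a _ => by gcongr; exact hvol a w
      _ = ENNReal.ofReal (∑ a ∈ A w, ‖v a - v (a - w)‖ ^ 2) * ENNReal.ofReal (∏ i : Fin 3, ℓ w i) := by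
          rw [← Finset.sum_mul, ENNReal.ofReal_sum_of_nonneg (fun a _ => sq_nonneg _)]
      _ ≤ ENNReal.ofReal (3 * (∑ j : Fin 3, ((w j : ℤ) : ℝ) ^ 2) * E) * ENNReal.ofReal (∏ i : Fin 3, ℓ w i) :=
          by gcongr; exact hM1 w hw
      _ = ENNReal.ofReal ((∏ i : Fin 3, ℓ w i) * (3 * (∑ j : Fin 3, ((w j : ℤ) : ℝ) ^ 2) * E)) := by
          rw [← ENNReal.ofReal_mul (by positivity), mul_comm]
  have hreal : ∑ w ∈ W, (∏ i : Fin 3, ℓ w i) * (3 * (∑ j : Fin 3, ((w j : ℤ) : ℝ) ^ 2) * E) ≤ 144 * (E / N) * (t ^ 2 + t) := by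
    have e : ∑ w ∈ W, (∏ i : Fin 3, ℓ w i) * (3 * (∑ j : Fin 3, ((w j : ℤ) : ℝ) ^ 2) * E)
        = 3 * E * ∑ w ∈ W, (∏ i : Fin 3, ℓ w i) * ∑ j : Fin 3, |((w j : ℤ) : ℝ)| ^ 2 := by
      rw [Finset.mul_sum]
      refine Finset.sum_congr rfl fun w _ => ?_
      simp only [sq_abs]; ring
    rw [e]
    refine sum_shifts_bound W hW hR1 ht0 hE _ fun w hw => ?_
    exact perShift_bound hR ht0 (ℓ w) (fun j => |((w j : ℤ) : ℝ)|) (hℓ0 w) (hℓ1 w) (fun j => abs_nonneg _)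
      (fun j => (hwabs w hw j).trans (by nlinarith [ht j, abs_nonneg (y j)])) (fun j => (hℓm w j).trans (by linarith [ht j]))
  ---- assemble
  calc ∫⁻ x, ‖f (x - y) - f x‖ₑ ^ 2 ≤ ∫⁻ x, G x := lintegral_mono hpt
    _ = (∑ w ∈ W, ∑ a ∈ A w, ENNReal.ofReal (‖v a - v (a - w)‖ ^ 2) * volume (T a w)) + ∑ i : Fin 3, volume (B i) := hint
    _ ≤ (∑ w ∈ W, ENNReal.ofReal ((∏ i : Fin 3, ℓ w i) * (3 * (∑ j : Fin 3, ((w j : ℤ) : ℝ) ^ 2) * E)))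
          + ∑ _i : Fin 3, ENNReal.ofReal (64 * t) :=
        add_le_add (Finset.sum_le_sum hinner) (Finset.sum_le_sum fun i _ => volume_stripBox_le ht0 i)
    _ = ENNReal.ofReal (∑ w ∈ W, (∏ i : Fin 3, ℓ w i) * (3 * (∑ j : Fin 3, ((w j : ℤ) : ℝ) ^ 2) * E)) + ENNReal.ofReal (192 * t) := by
        have hstrip : ∑ _i : Fin 3, ENNReal.ofReal (64 * t) = ENNReal.ofReal (192 * t) := by
          rw [Finset.sum_const, Finset.card_univ, Fintype.card_fin, ← ENNReal.ofReal_nsmul, nsmul_eq_mul]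
          congr 1; push_cast; ring
        rw [hstrip, ENNReal.ofReal_sum_of_nonneg (fun w _ => by
          exact mul_nonneg (Finset.prod_nonneg fun i _ => hℓ0 w i) (by positivity))]
    _ ≤ ENNReal.ofReal (144 * (E / N) * (t ^ 2 + t)) + ENNReal.ofReal (192 * t) :=
        add_le_add (ENNReal.ofReal_le_ofReal hreal) le_rfl
    _ = ENNReal.ofReal (144 * (E / N) * (t ^ 2 + t) + 192 * t) :=
        (ENNReal.ofReal_add (by positivity) (by positivity)).symm

end Summit.QuantumFields.YangMills.Theorems.PoincareLipschitzTranslationModulus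

end
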